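import Mathlib

/-!
# The one-parameter family of near-threshold inner solutions (third-order pattern equation)

Kernel of solo-blind paper §24.17(5)(e).  The leading-order columnar (`n = ∞`) steady pattern
problem near threshold is the third-order free-boundary problem `Q‴ = 1 - s²` on the support of
`Q`, `Q ≥ 0`, `Q = Q' = 0` at both contacts (scaled form, `β₃ > 0`; the case `β₃ < 0` is the mirror
image).  Counting constants (three of integration, two contact points; four contact conditions)
leaves ONE free parameter, and indeed the admissible solutions form a one-parameter family:

  `Q_{a,b}(s) = (s - a)² (s - b)² (r - s) / 60`,  `r = -2(a + b)`,

solves `Q‴ = 1 - s²` exactly iff `3a² + 4ab + 3b² = 10` (an ellipse in the `(a,b)` plane), has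
double zeros at `a` and `b`, contact curvatures `Q''(a) = (a-b)²(-(3a+2b))/30`,
`Q''(b) = (a-b)²(-(2a+3b))/30`, and is nonnegative on `s ≤ b` iff `2a + 3b ≤ 0` (fifth root
`r ≥ b`).  The admissible arc runs from the degenerate point `a = b = -1` (patterns shrinking onto
the threshold leaf `s = -1`) to the extreme member `2a + 3b = 0`, i.e. `(a, b) = (-√6, 2√6/3)`,
which is the explicit solution with a C² contact of `SoloBlindCubicInnerSolution`.
All statements are polynomial identities / inequalities over `ℝ`.
-/

namespace Summit.AnomalousDissipation.AnomalousDissipation.Theorems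

/-- The family profile `Q_{a,b}(s) = (s-a)²(s-b)²(-2a-2b-s)/60`. -/
noncomputable def cubicFamilyQ (a b s : ℝ) : ℝ :=
  (s - a) ^ 2 * (s - b) ^ 2 * (-2 * a - 2 * b - s) / 60

/-- Its first derivative (expanded; note the absent `s³` term). -/
noncomputable def cubicFamilyQ1 (a b s : ℝ) : ℝ :=
  (-1/12 : ℝ) * s ^ 4 + (3/20 * a ^ 2 + 1/5 * a * b + 3/20 * b ^ 2) * s ^ 2
    + (-1/15 * a ^ 3 - 4/15 * a ^ 2 * b - 4/15 * a * b ^ 2 - 1/15 * b ^ 3) * s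
    + (1/15 * a ^ 3 * b + 7/60 * a ^ 2 * b ^ 2 + 1/15 * a * b ^ 3)

/-- Its second derivative. -/
noncomputable def cubicFamilyQ2 (a b s : ℝ) : ℝ :=
  (-1/3 : ℝ) * s ^ 3 + (3/10 * a ^ 2 + 2/5 * a * b + 3/10 * b ^ 2) * s
    + (-1/15 * a ^ 3 - 4/15 * a ^ 2 * b - 4/15 * a * b ^ 2 - 1/15 * b ^ 3)

/-- Its third derivative. -/
noncomputable def cubicFamilyQ3 (a b s : ℝ) : ℝ :=
  (-1 : ℝ) * s ^ 2 + (3/10 * a ^ 2 + 2/5 * a * b + 3/10 * b ^ 2)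

/-- `Q' = Q₁`. -/
theorem hasDerivAt_cubicFamilyQ (a b s : ℝ) :
    HasDerivAt (cubicFamilyQ a b) (cubicFamilyQ1 a b s) s := by
  have h1 : HasDerivAt (fun x : ℝ => x - a) 1 s := (hasDerivAt_id' s).sub_const a
  have h2 : HasDerivAt (fun x : ℝ => x - b) 1 s := (hasDerivAt_id' s).sub_const b
  have h3 : HasDerivAt (fun x : ℝ => -2 * a - 2 * b - x) (-1) s := by
    simpa using (hasDerivAt_id' s).const_sub (-2 * a - 2 * b)
  have h := (((h1.pow 2).mul (h2.pow 2)).mul h3).div_const 60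
  unfold cubicFamilyQ
  refine h.congr_deriv ?_
  simp only [cubicFamilyQ1, Pi.pow_apply, Pi.mul_apply, Nat.cast_ofNat, show (2:ℕ) - 1 = 1 from rfl,
    pow_one]
  ring

/-- `Q₁' = Q₂`. -/
theorem hasDerivAt_cubicFamilyQ1 (a b s : ℝ) :
    HasDerivAt (cubicFamilyQ1 a b) (cubicFamilyQ2 a b s) s := by
  have h := ((((hasDerivAt_pow 4 s).const_mul (-1/12 : ℝ)).add
    ((hasDerivAt_pow 2 s).const_mul (3/20 * a ^ 2 + 1/5 * a * b + 3/20 * b ^ 2))).add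
    ((hasDerivAt_id' s).const_mul
      (-1/15 * a ^ 3 - 4/15 * a ^ 2 * b - 4/15 * a * b ^ 2 - 1/15 * b ^ 3))).add_const
    (1/15 * a ^ 3 * b + 7/60 * a ^ 2 * b ^ 2 + 1/15 * a * b ^ 3)
  unfold cubicFamilyQ1
  refine h.congr_deriv ?_
  simp only [cubicFamilyQ2, Nat.cast_ofNat, show (4:ℕ) - 1 = 3 from rfl,
    show (2:ℕ) - 1 = 1 from rfl, pow_one]
  ring

/-- `Q₂' = Q₃`. -/
theorem hasDerivAt_cubicFamilyQ2 (a b s : ℝ) :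
    HasDerivAt (cubicFamilyQ2 a b) (cubicFamilyQ3 a b s) s := by
  have h := (((hasDerivAt_pow 3 s).const_mul (-1/3 : ℝ)).add
    ((hasDerivAt_id' s).const_mul (3/10 * a ^ 2 + 2/5 * a * b + 3/10 * b ^ 2))).add_const
    (-1/15 * a ^ 3 - 4/15 * a ^ 2 * b - 4/15 * a * b ^ 2 - 1/15 * b ^ 3)
  unfold cubicFamilyQ2
  refine h.congr_deriv ?_
  simp only [cubicFamilyQ3, Nat.cast_ofNat, show (3:ℕ) - 1 = 2 from rfl]
  ring

/-- On the ellipse `3a² + 4ab + 3b² = 10` the family solves the inner equation `Q‴ = 1 - s²`. -/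
theorem cubicFamilyQ3_eq (a b : ℝ) (hE : 3 * a ^ 2 + 4 * a * b + 3 * b ^ 2 = 10) (s : ℝ) :
    cubicFamilyQ3 a b s = 1 - s ^ 2 := by
  unfold cubicFamilyQ3
  linear_combination (1/10 : ℝ) * hE

/-- Double zero (C¹ contact) at `s = a`, with contact curvature `Q''(a) = (a-b)²(-(3a+2b))/30`. -/
theorem cubicFamilyQ_contact_left (a b : ℝ) :
    cubicFamilyQ a b a = 0 ∧ cubicFamilyQ1 a b a = 0 ∧
      cubicFamilyQ2 a b a = (a - b) ^ 2 * (-(3 * a + 2 * b)) / 30 := by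
  refine ⟨?_, ?_, ?_⟩ <;> simp only [cubicFamilyQ, cubicFamilyQ1, cubicFamilyQ2] <;> ring

/-- Double zero (C¹ contact) at `s = b`, with contact curvature `Q''(b) = (a-b)²(-(2a+3b))/30`
(so the contact at `b` is C² exactly for the extreme member `2a + 3b = 0`). -/
theorem cubicFamilyQ_contact_right (a b : ℝ) :
    cubicFamilyQ a b b = 0 ∧ cubicFamilyQ1 a b b = 0 ∧
      cubicFamilyQ2 a b b = (a - b) ^ 2 * (-(2 * a + 3 * b)) / 30 := by
  refine ⟨?_, ?_, ?_⟩ <;> simp only [cubicFamilyQ, cubicFamilyQ1, cubicFamilyQ2] <;> ring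

/-- Admissibility: if the fifth root lies to the right of `b` (`2a + 3b ≤ 0`) then `Q ≥ 0` on `s ≤ b`,
in particular on the whole support `[a, b]`. -/
theorem cubicFamilyQ_nonneg (a b s : ℝ) (hadm : 2 * a + 3 * b ≤ 0) (hs : s ≤ b) :
    0 ≤ cubicFamilyQ a b s := by
  unfold cubicFamilyQ
  have h3 : 0 ≤ -2 * a - 2 * b - s := by linarith
  have h12 : 0 ≤ (s - a) ^ 2 * (s - b) ^ 2 := mul_nonneg (sq_nonneg _) (sq_nonneg _)
  exact div_nonneg (mul_nonneg h12 h3) (by norm_num)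

/-- Conversely, if `2a + 3b > 0` and `a ≠ b` the profile is negative just inside the contact `b`
(contact curvature `Q''(b) < 0`), so `2a + 3b ≤ 0` is also necessary for admissibility near `b`. -/
theorem cubicFamilyQ2_right_neg (a b : ℝ) (hab : a ≠ b) (h : 0 < 2 * a + 3 * b) :
    cubicFamilyQ2 a b b < 0 := by
  rw [(cubicFamilyQ_contact_right a b).2.2]
  have hsq : 0 < (a - b) ^ 2 := by
    have : a - b ≠ 0 := sub_ne_zero.mpr hab
    positivity
  have : (a - b) ^ 2 * (-(2 * a + 3 * b)) < 0 :=
    mul_neg_of_pos_of_neg hsq (by linarith)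
  linarith

/-- Summary: for every `(a, b)` on the arc `3a² + 4ab + 3b² = 10`, `2a + 3b ≤ 0`, the profile
`Q_{a,b}` is a classical solution of `Q‴ = 1 - s²` with C¹ contacts at `a` and `b`, nonnegative on
`s ≤ b`: a one-parameter family of admissible near-threshold steady patterns. -/
theorem cubicFamily_solution (a b : ℝ) (hE : 3 * a ^ 2 + 4 * a * b + 3 * b ^ 2 = 10)
    (hadm : 2 * a + 3 * b ≤ 0) :
    (∀ s, HasDerivAt (cubicFamilyQ a b) (cubicFamilyQ1 a b s) s) ∧
    (∀ s, HasDerivAt (cubicFamilyQ1 a b) (cubicFamilyQ2 a b s) s) ∧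
    (∀ s, HasDerivAt (cubicFamilyQ2 a b) (1 - s ^ 2) s) ∧
    (∀ s, s ≤ b → 0 ≤ cubicFamilyQ a b s) ∧
    cubicFamilyQ a b a = 0 ∧ cubicFamilyQ1 a b a = 0 ∧
    cubicFamilyQ a b b = 0 ∧ cubicFamilyQ1 a b b = 0 :=
  ⟨hasDerivAt_cubicFamilyQ a b, hasDerivAt_cubicFamilyQ1 a b,
    fun s => (hasDerivAt_cubicFamilyQ2 a b s).congr_deriv (cubicFamilyQ3_eq a b hE s),
    fun s hs => cubicFamilyQ_nonneg a b s hadm hs,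
    (cubicFamilyQ_contact_left a b).1, (cubicFamilyQ_contact_left a b).2.1,
    (cubicFamilyQ_contact_right a b).1, (cubicFamilyQ_contact_right a b).2.1⟩

/-- The extreme member `(a, b) = (-√6, 2√6/3)` lies on the arc with `2a + 3b = 0` (C² contact at `b`):
it is the explicit solution of `SoloBlindCubicInnerSolution` (`u = 2√6/3 = √(8/3)`, `v = √6`). -/
theorem cubicFamily_extreme_member :
    3 * (-Real.sqrt 6) ^ 2 + 4 * (-Real.sqrt 6) * (2 * Real.sqrt 6 / 3)
        + 3 * (2 * Real.sqrt 6 / 3) ^ 2 = 10 ∧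
      2 * (-Real.sqrt 6) + 3 * (2 * Real.sqrt 6 / 3) = 0 := by
  have h6 : Real.sqrt 6 ^ 2 = 6 := Real.sq_sqrt (by norm_num)
  constructor
  · linear_combination (5/3 : ℝ) * h6
  · ring

/-- The degenerate end of the arc: `a = b = -1` lies on the ellipse with `2a + 3b = -5 < 0`
(patterns shrinking onto the threshold leaf `s = -1`). -/
theorem cubicFamily_degenerate_member :
    3 * (-1 : ℝ) ^ 2 + 4 * (-1) * (-1) + 3 * (-1) ^ 2 = 10 ∧ 2 * (-1 : ℝ) + 3 * (-1) ≤ 0 := by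
  constructor <;> norm_num

/-- The local flank family: near a simple threshold crossing (`σ - K₀ ≈ σ'·(c - c₀)`) the quartic
`q(c) = κ ((c - c₀)² - w²)²` solves the third-order equation with a LINEAR right-hand side,
`q‴ = 24 κ (c - c₀)`, has C¹ contacts at `c₀ ± w`, and is nonnegative iff `κ ≥ 0`
(i.e. `σ'(c₀)` and `β₃` of the same sign), for every half-width `w`. -/
theorem flankFamily (κ c₀ w c : ℝ) :
    HasDerivAt (fun x => κ * ((x - c₀) ^ 2 - w ^ 2) ^ 2)
        (κ * (2 * ((c - c₀) ^ 2 - w ^ 2) * (2 * (c - c₀)))) c ∧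
      HasDerivAt (fun x => κ * (2 * ((x - c₀) ^ 2 - w ^ 2) * (2 * (x - c₀))))
        (κ * (12 * (c - c₀) ^ 2 - 4 * w ^ 2)) c ∧
      HasDerivAt (fun x => κ * (12 * (x - c₀) ^ 2 - 4 * w ^ 2)) (24 * κ * (c - c₀)) c ∧
      (0 ≤ κ → 0 ≤ κ * ((c - c₀) ^ 2 - w ^ 2) ^ 2) ∧
      κ * (((c₀ + w) - c₀) ^ 2 - w ^ 2) ^ 2 = 0 ∧ κ * (((c₀ - w) - c₀) ^ 2 - w ^ 2) ^ 2 = 0 ∧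
      κ * (2 * (((c₀ + w) - c₀) ^ 2 - w ^ 2) * (2 * ((c₀ + w) - c₀))) = 0 ∧
      κ * (2 * (((c₀ - w) - c₀) ^ 2 - w ^ 2) * (2 * ((c₀ - w) - c₀))) = 0 := by
  have h0 : HasDerivAt (fun x : ℝ => x - c₀) 1 c := (hasDerivAt_id' c).sub_const c₀
  refine ⟨?_, ?_, ?_, ?_, by ring, by ring, by ring, by ring⟩
  · have h := (((h0.pow 2).sub_const (w ^ 2)).pow 2).const_mul κ
    refine h.congr_deriv ?_
    simp only [Pi.pow_apply, Nat.cast_ofNat, show (2:ℕ) - 1 = 1 from rfl, pow_one]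
    ring
  · have h := ((((h0.pow 2).sub_const (w ^ 2)).const_mul 2).mul (h0.const_mul 2)).const_mul κ
    refine h.congr_deriv ?_
    simp only [Pi.pow_apply, Nat.cast_ofNat, show (2:ℕ) - 1 = 1 from rfl, pow_one]
    ring
  · have h := (((h0.pow 2).const_mul 12).sub_const (4 * w ^ 2)).const_mul κ
    refine h.congr_deriv ?_
    simp only [Nat.cast_ofNat, show (2:ℕ) - 1 = 1 from rfl, pow_one]
    ring
  · intro hk
    exact mul_nonneg hk (sq_nonneg _)

end Summit.AnomalousDissipation.AnomalousDissipation.Theorems
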